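import Literature.AlgebraicGeometry.Resolution.RankOneReductionProofs
import HarnessLib

/-!
# Relative local uniformization of a composite valuation from the coarsening and the residue
# valuation (Novacoski–Spivakovsky's composite step for one pair `O ≤ O₁`, general form)

Support file for crux stmt-ResolutionOfSingularities-16087 (`ValuativeSmoothing`, route file
`Theses/IndSmooth.lean`), line `birth`, wave 6: the registered stub `stub_relLUCompositeStep`.

For fields `k ⊆ K` and valuation rings `O ≤ O₁` of `K` with `k ⊆ O₁` (so `ν_O = ν₁ ∘ ν₂`,
`ν₁ = ν_{O₁}`, `ν₂` the valuation of the residue field `κ(O₁)` with ring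
`O / 𝔪_{O₁} = residueValuationSubring O O₁ _`), SUPPOSE
* `ν₁` admits relative local uniformization over `k` (`h₁ : RelLocalUniformization k K O₁`);
* for every field `κ ⊇ k` and every ring map `ι : κ → κ(O₁)` compatible with `k`
  (`ι ∘ (k → κ) = residue ∘ (k → O₁)`), the restriction
  `(residueValuationSubring O O₁ _).comap ι` of `ν₂` along `ι` admits relative local
  uniformization over `k` (`h₂`).
THEN `O` admits relative local uniformization over `k` (`stub_relLUCompositeStep`).

This is the general form of the composite step: no hypothesis on the residue field of `O₁`
(compare `relLU_of_le_of_relLU_residue` of `IndSmoothValuativeSmoothingRelLUResidueGeneral.lean`,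
where the residue field is generated by finitely many residues and `ι` is required bijective).

**Proof.** The assembly of Novacoski–Spivakovsky's proof of their Thm. 1.1 (§3.1) for the single
decomposition `ν = ν₁ ∘ ν₂`, exactly as in the tree's `NovacoskiSpivakovsky2014_holds` but with
the two inductive inputs replaced by `h₁` and `h₂`. Given an affine model `R ⊆ O`
(`R` finitely generated over `k`, `Frac R = K`), Cor. 2.14 (`novacoskiSpivakovsky2014_cor214`,
input `h₁`) gives a finitely generated `A₁ ⊇ R` inside `O` which is regular at the centre of
`ν₁`. Cor. 2.17 (`novacoskiSpivakovsky2014_cor217`) consumes, for a field `κ ⊇ k`, a ring map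
`ι : κ → κ(O₁)` and a `k`-algebra map `φ : A₁ → κ` with `ι ∘ φ = residue` and
`Frac φ(A₁) = κ`, a `ν₂`-uniformizing model above the residue ring `φ(A₁) ⊆ κ`: since `φ` is a
`k`-algebra map, `ι` is compatible with `k` (`ι (c · 1_κ) = ι (φ (c · 1)) = residue (c · 1)`),
so `h₂` gives relative local uniformization of the restriction `(O / 𝔪_{O₁}).comap ι` of `ν₂`,
which applies to the finitely generated model `φ(A₁)` (image of the finitely generated `A₁`;
it lies in the restricted valuation ring because the residues of `A₁ ⊆ O` lie in `O / 𝔪_{O₁}`,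
`residue_mem_residueValuationSubring_iff`). The final step of §3.1
(`novacoskiSpivakovsky2014_step`, over the Noetherian base `k`) then produces the regular model
above `R`; fraction fields are propagated along `R ≤ A₁ ≤ A₂` by
`isFractionRing_subalgebra_of_le`.

## Source

J. Novacoski, M. Spivakovsky, *Reduction of local uniformization to the rank one case*,
Valuation Theory in Interaction (Segovia–El Escorial 2011), EMS Ser. Congr. Rep. (2014)
404–431; arXiv:1204.4751v1: Cor. 2.14 (p. 9), Cor. 2.17 (p. 11), §3.1 (pp. 13–15).
[NovacoskiSpivakovsky2014]
-/

-- single-problem summit: the doubled namespace component is forced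
set_option linter.dupNamespace false

namespace Summit.ResolutionOfSingularities.ResolutionOfSingularities.Theorems.ValuativeSmoothing

open IsLocalRing Literature.AlgebraicGeometry.Resolution

/-- **Relative local uniformization of a composite valuation from its two components, general
form** (Novacoski–Spivakovsky 2014, proof of Thm. 1.1, §3.1, for ONE decomposition
`ν = ν₁ ∘ ν₂`). Let `k ⊆ K` be fields and `O ≤ O₁` valuation rings of `K` with `k ⊆ O₁` (`hk`).
If `ν₁ = ν_{O₁}` admits relative local uniformization over `k` (`h₁`) and so does the
restriction `(O / 𝔪_{O₁}).comap ι` of the residue valuation to every field `κ ⊇ k` along every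
`k`-compatible ring map `ι : κ → κ(O₁)` (`h₂`), then `O` admits relative local uniformization
over `k`. Proof = the three steps of the tree's `NovacoskiSpivakovsky2014_holds` for this single
decomposition: Cor. 2.14 (`novacoskiSpivakovsky2014_cor214`, input `h₁`), Cor. 2.17
(`novacoskiSpivakovsky2014_cor217`, whose callback `(κ, ι, φ)` is `k`-compatible because `φ` is
a `k`-algebra map, so `h₂` applies to the model `φ.range`), §3.1
(`novacoskiSpivakovsky2014_step`). [cite: NovacoskiSpivakovsky2014, Cor. 2.14, Cor. 2.17 and §3.1] -/
theorem stub_relLUCompositeStep (k K : Type) [Field k] [Field K] [Algebra k K]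
    (O O₁ : ValuationSubring K) (hO : O ≤ O₁) (hk : ∀ c : k, algebraMap k K c ∈ O₁)
    (h₁ : RelLocalUniformization k K O₁)
    (h₂ : ∀ (κ : Type) [Field κ] [Algebra k κ] (ι : κ →+* IsLocalRing.ResidueField O₁),
      (∀ c : k, ι (algebraMap k κ c) = IsLocalRing.residue O₁ ⟨algebraMap k K c, hk c⟩) →
      RelLocalUniformization k κ ((residueValuationSubring O O₁ hO).comap ι)) :
    RelLocalUniformization k K O := by
  intro R hR hfrac hRO
  -- Step 1: Cor. 2.14 with the local uniformization `h₁` of `ν₁`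
  obtain ⟨A₁, hA₁, hRA₁, hA₁fg, hreg₁⟩ :=
    novacoskiSpivakovsky2014_cor214 O O₁ hO R hR hfrac hRO (h₁ R hR hfrac (hRO.trans hO))
  haveI := hfrac
  haveI hfrac₁ : IsFractionRing A₁ K := isFractionRing_subalgebra_of_le R A₁ hRA₁
  -- Step 2: the input of Cor. 2.17 from `h₂` on the residue chart `κ ⊇ φ(A₁)`
  have ih₂' : ∀ (κ : Type) [Field κ] [Algebra k κ] (ι : κ →+* ResidueField O₁) (φ : A₁ →ₐ[k] κ),
      (∀ a : A₁, ι (φ a) = residue O₁ ⟨(a : K), (hA₁.trans hO) a.2⟩) →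
      IsFractionRing φ.range κ →
      ∃ (B : Subalgebra k κ)
        (hB : B.toSubring ≤ ((residueValuationSubring O O₁ hO).comap ι).toSubring),
        φ.range ≤ B ∧ B.FG ∧
        IsRegularLocalRing (Localization.AtPrime
          ((maximalIdeal ((residueValuationSubring O O₁ hO).comap ι)).comap
            (Subring.inclusion hB))) := by
    intro κ _ _ ι φ hφ hfr
    -- `ι` is compatible with `k` because `φ` is a `k`-algebra map
    have hιk : ∀ c : k, ι (algebraMap k κ c) = residue O₁ ⟨algebraMap k K c, hk c⟩ := by
      intro c
      rw [← φ.commutes c, hφ]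
      rfl
    have hLU : RelLocalUniformization k κ ((residueValuationSubring O O₁ hO).comap ι) :=
      h₂ κ ι hιk
    have hfg : φ.range.FG := by
      have h := ((Subalgebra.fg_top A₁).mpr hA₁fg).map φ
      rwa [Algebra.map_top] at h
    have hle : φ.range.toSubring ≤ ((residueValuationSubring O O₁ hO).comap ι).toSubring := by
      intro z hz
      obtain ⟨a, rfl⟩ := (AlgHom.mem_range φ).mp (show z ∈ φ.range from hz)
      change φ a ∈ (residueValuationSubring O O₁ hO).comap ι
      rw [ValuationSubring.mem_comap, hφ]
      exact (residue_mem_residueValuationSubring_iff O O₁ hO _).mpr (hA₁ a.2)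
    exact hLU φ.range hfg hfr hle
  obtain ⟨A₂, hA₂, hA₁₂, hA₂fg, hreg₂, hreg₂'⟩ :=
    novacoskiSpivakovsky2014_cor217 O O₁ hO A₁ hA₁ hA₁fg hfrac₁ hreg₁ ih₂'
  haveI hfrac₂ : IsFractionRing A₂ K := isFractionRing_subalgebra_of_le A₁ A₂ hA₁₂
  -- Step 3: the final step of §3.1
  obtain ⟨A₃, hA₃, hA₂₃, hA₃fg, hreg₃⟩ :=
    novacoskiSpivakovsky2014_step O O₁ hO A₂ hA₂ hA₂fg hfrac₂ hreg₂ hreg₂'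
  exact ⟨A₃, hA₃, hRA₁.trans (hA₁₂.trans hA₂₃), hA₃fg, hreg₃⟩

end Summit.ResolutionOfSingularities.ResolutionOfSingularities.Theorems.ValuativeSmoothing
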